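import Summits.AtomisticToContinuum.Crystallization.Theorems.ChartedZeroExcessLayeredLatticeLiouvilleTE

/-!
# Zero-excess layered lattice Liouville — part TG (lens-2 g34, node «BondIsoAnchoring» beneath (A0) of part TB): the estimate half (A0♯)
`GraphLevelsP` of part TE is REFUTED at the literals (paper level: the equilibrium chart handed to it is tied to the configuration only by SOME
scale-`R` registration and SOME tear-free bijection, and a far coherent twin of the chart defeats every global registration — §X.1), and the cut is
REPAIRED one notch up: (A0⁺) `GlobalChartIsoRegistrationP` ((A0) with the global registration a BOND ISOMORPHISM — what (A0)'s mechanism gives;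
(A0⁺) ⇒ (A0) PROVED) ⟸ (A0♭⁺) `EquilChartBondIsoP` (existence: ONE map that is a bijective bond isomorphism, tear-free, AND registers `win R`) ∧
(A0♯⁺) `BondIsoLevelsP` (levels `Cg·(D/R)·η` at every scale for THAT map), glue PROVED, (A0⁺) ⇒ (A0♭⁺) PROVED, (A0♭⁺) ⇒ (A0♭) PROVED, the level
bookkeeping of (A0♯⁺) PROVED (`isRegistered_of_bijOn_dominating`, `isGlobalReg_of_bijOn_levels`), columns `_16XH9` / `_16XH9W` (17 leaves; supersede
`_16XH8`).  Node memo: `NODE-g34-BondIsoAnchoring.md` (witness numerics: `g34/instrument/twin_tail.py`).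
0 EQUIV; placeholder-free; no type-class declarations, custom syntax or option pragmas.
-/

noncomputable section

open scoped BigOperators InnerProductSpace RealInnerProductSpace
open MeasureTheory Set Metric Filter Topology
open Summit.AtomisticToContinuum.Crystallization.Theorems.ChartedPlanarOrderRigidityDoor
  (E3 IsClean IsNash IsCharted IsEStarGSC VisibleGap PertRegime atomsIn siteEnergy eStar BindingSurface)
open Summit.AtomisticToContinuum.Crystallization.Theorems.ChartedPlanarOrderDensityDichotomy (μS IsSep nK nK_nonneg excess)
open Summit.AtomisticToContinuum.Crystallization.Theorems.ChartedPlanarOrderMesoCut (IsDoorSet NearHom LayeredHom EnvClose)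
open Summit.AtomisticToContinuum.Crystallization.Theorems.OverbindingBudgetLiouvilleDictionary (NearHomBD)
open Summit.AtomisticToContinuum.Crystallization.Theorems.ChartedPlanarOrderDoorLayered
  (TwoPeriodic DoorPeriodic PeriodicBulkGapDoor gap_and_pert_1_50_of_periodic NearHomL2BD nearHomL2BD_mono nearHomBD_of_nearHomL2BD
   sq_le_finsum_mem not_nearHomL2BD_singleton envClose_mono Layered layeredHom_eq_layered atomsIn_subset)
open Summit.AtomisticToContinuum.Crystallization.Theorems.ChartedPlanarOrderDoorLayeredOsc (IsTwoShellAffineGood DoorPeriodicOsc)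
open Summit.AtomisticToContinuum.Crystallization.Theorems.ChartedPlanarOrderCleanScaleP
  (IsCleanP IsDoorSetP DoorPeriodicP isDoorSetP_mono doorPeriodic_of_doorPeriodicP isDoorSetP_one_iff doorPeriodicP_one_iff)
open Summit.AtomisticToContinuum.Crystallization.Theorems.ChartedPlanarOrderProfileSlavingLJ (pairForce)
open Literature.MathematicalPhysics.StatisticalMechanics (haggLabel barlowOffset layerNormal IsHaggSeq triangularVec₁ triangularVec₂)

namespace Summit.AtomisticToContinuum.Crystallization.Theorems.ChartedZeroExcessLayeredLatticeLiouville

/-! ## §X  (lens-2 g34, node «BondIsoAnchoring» beneath (A0)): the estimate half (A0♯) `GraphLevelsP` of part TE is REFUTED (paper level) and the cut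
is REPAIRED — (A0⁺) `GlobalChartIsoRegistrationP` ⟸ (A0♭⁺) `EquilChartBondIsoP` ∧ (A0♯⁺) `BondIsoLevelsP`, glue / projection / consequence / seam PROVED,
the level bookkeeping of (A0♯⁺) PROVED (`isRegistered_of_bijOn_dominating`, `isGlobalReg_of_bijOn_levels`), columns `_16XH9` / `_16XH9W` (17 leaves).

### X.1  Why (A0♯) is false as typed (the structural dichotomy: BOND-ISOMORPHIC registrations are rigid, merely TEAR-FREE ones are not)
(A0♯) hands the estimate an equilibrium chart `H` tied to `S` only by (i) SOME registration of the window `win R` and (ii) SOME tear-free bijection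
`Ψ₀ : S → H` (`4 ↦ 8` both ways).  Neither forces `H` to carry `S`'s Hägg word BEYOND the registered window: a coherent twin or a thin foreign lamella of
`H` far above height `R` is invisible to (i), and (ii) survives it because matching fcc-layer `m` to `H`-layer `m` laterally (shift `≤ d₀/√3 ≈ 0.561` per
layer) moves `4`-neighbours to distance `≤ 5.2 ≤ 8`.  WITNESS (literals `(1; 2, 1/16, 1/50)`): `S :=` perfect fcc at the e⋆-scale `d₀ = 0.971237` (door set;
θ-good by `isTwoShellAffineGood_of_good`; registered-flat at level `0` at EVERY scale under its own chart `(d₀•id, w_fcc, id, τ = 0)`, so the multi-scale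
hypothesis holds for every `η > 0`); `H := LayeredHom (d₀•id) w_twin`, the RELAXED COHERENT TWIN of fcc with the twin plane at height `2R` (1-D layer-chain
numerics, instrument `g34/instrument/twin_tail.py` on g33's `layerchain.py`: force residual `1e-13`, clean margin `0.0607`, exclusion margin `0.129`, chain
`λ_min = 18.88`, site Hessian `λ_min = 39.6`, hole gap `30.5` — the margins of fcc itself; relaxation tail `|h_k − h_fcc| = 3.1e-5, 7.9e-7, 1.3e-7, …,
≤ 4e-10` beyond `10` layers, cumulative `6.4e-5`), registering `win R` by the near-identity at level `≤ 1e-16·nK` for `R ≥ 8`, and `Ψ₀ :=` the layerwise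
lateral matching.  Every hypothesis of (A0♯) holds, but NO `Ψ` is an `IsGlobalReg Cg η R S H Ψ`: above the twin plane two `S`-layers in three are laterally
mis-registered against the `H`-layer at the same height, so each of their sites has `‖x − Ψ x‖ ≥ 0.56` whatever `Ψ` does (same height: a lateral offset
`≥ d₀/√3`; another height: `≥ 0.79`); they are `≥ (2/3)·(5/32) ≈ 10 %` of `win 4R` (the cap `z ≥ 2R` of the ball of radius `4R`), whence
`Σ_{win 4R} ‖x − Ψ x‖² ≥ 0.031·nK(win 4R)`, while the position budget of `IsGlobalReg` at `D = 4R` is `Cg·4·η·(4R)²·nK = 64·Cg·η·R²·nK` — violated as soon as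
`η < 4.8·10⁻⁴/(Cg·R²)`, and (A0♯) lets `η ≤ η₁` and `R ≥ R₁` be chosen AFTER `Cg` (take `R := max R₁ 8`).  LOAD-BEARING ANALYSIS of the repair: the same
witness with `Ψ₀ :=` the near-identity registration itself (TIED to scale `R`, tear-free, NOT bond-isomorphic across the twin plane) kills «tied ∧ tear-free»;
`S :=` a relaxed fcc|hcp bicrystal (interface at height `2R`), `H := S` translated by three layers, `Ψ₀ :=` the translation (bond-isomorphic, UNTIED to the
near-identity registration of `win R`) kills «bond-iso ∧ untied» in the thin regime `η·R² ≪ 1` (position cost `≥ 5.6` per site for the translation, `≥ 0.3`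
per site on `≈ 15 %` of `win 4R` for anything near the identity, a glide between the two costs `≥ 5.6` per site on a slab).  Hence BOTH hypotheses added
below — the SAME map `Ψ₀` registers `win R`, and `Ψ₀` preserves first-shell bonds — are necessary; (A0) itself is untouched (its prover picks the chart
with `S`'s own word), and (A0)'s intended mechanism (TB docstring: «Ψ := the graph isomorphism») delivers exactly a bond isomorphism, so (A0⁺) loses nothing.

### X.2  The repaired cut (one EQUIV-free layer; every piece over EXPLICIT data so the pieces compose)
  (A0⁺) `GlobalChartIsoRegistrationP` ⟸ (A0♭⁺) `EquilChartBondIsoP` ∧ (A0♯⁺) `BondIsoLevelsP` — `globalChartIsoRegistrationP_of_bondIso_levels` (PROVED);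
  (A0⁺) ⇒ (A0) (`globalChartRegistrationP_of_iso`, PROVED: projection), (A0⁺) ⇒ (A0♭⁺) (`equilChartBondIsoP_of_globalChartIsoRegistrationP`, PROVED: `D = R`),
  (A0♭⁺) ⇒ (A0♭) of part TE (`equilChartGraphP_of_equilChartBondIsoP`, PROVED).  «Bond» = a pair at distance `≤ 28/25`, the `IsCharted` currency: on
  `(1/16, 9/10, 1)`-clean configurations (both `S` and `H` are) first-shell pairs have length `≤ 17/16 < 28/25` and every other pair `≥ (9/10)(√2 − 1/16) > 6/5`,
  so `IsBondIso` is exactly «graph isomorphism of the contact graphs».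
| piece | type | status / tag | why strictly weaker than (A0⁺) | size |
|---|---|---|---|---|
| (A0♭⁺) `EquilChartBondIsoP` | EXISTENCE (S-dependent: an equilibrium chart carrying `S`'s OWN global word, with ONE map that is a bond isomorphism AND registers `win R` at level `C♭·η`) | WEAKER ((A0⁺) ⇒ (A0♭⁺) PROVED) · TRUE-expected · UNDECIDED · INSTRUMENTABLE | asks levels at the single scale `R` only; (A0♯⁺) is not free (drift/slaving estimates at all scales) | M–L |
| (A0♯⁺) `BondIsoLevelsP` | SLAVING / DRIFT ESTIMATE for a GIVEN bond-isomorphic registration (no existence content; pure geometry of `S` + layer-chain slaving) | TRUE-type · ATTACKABLE · bookkeeping step PROVED here | assumes the chart and the map that (A0⁺) must produce | M–L |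
Skeleton of (A0♯⁺) (memo §4): L1 automorphism pinning (a bond isomorphism registered at level `C♭·η`, `η ≤ η₁(C♭)`, is orientation-true: no rotation /
mirror relabelling survives the gradient level) · L2 dyadic chart comparison (affine-fit rigidity: `‖L_{2D}∘A_{2D} − L_D∘A_D‖ ≤ C√η`, telescoped to
`C√η·log₂(D/R)`) · L3 profile transport (`τ₀² ≤ 2τ_D² + C‖L_D∘A_D − L‖²`) · L4 interlayer slaving (`S` Nash ⇒ its layer offsets follow the homogeneous
equilibrium offsets of its own word; lens-3 `SlavingKernelL1` / `TubeMonotone`) · L5 position from gradient (discrete Poincaré on the contact graph, anchored at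
scale `R`) · L6 = `isGlobalReg_of_bijOn_levels` (PROVED).  Census TAG 174 (a⁗) (W174.md): interior wild mass EXACTLY `0` on all relaxed states — consistent
with L3's transported profile being tame.
-/

/-- ★ **bond isomorphism clause** `IsBondIso S Ψ`: `Ψ` preserves AND reflects the relation «distance `≤ 28/25`» between sites of `S` (the bond currency of
`IsCharted`).  On `(1/16, 9/10, 1)`-clean configurations this relation is exactly first-shell adjacency (`17/16 < 28/25 < (9/10)(√2 − 1/16)`), so together
with `Set.BijOn Ψ S H` it says: `Ψ` is an isomorphism of contact graphs — the STRUCTURED class of registrations (rigid: determined by one site's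
neighbourhood), as opposed to merely tear-free bijections (§X.1). [this file, g34] -/
def IsBondIso (S : Set E3) (Ψ : E3 → E3) : Prop :=
  ∀ x ∈ S, ∀ p ∈ S, (dist p x ≤ 28 / 25 ↔ dist (Ψ p) (Ψ x) ≤ 28 / 25)

/-- the identity is a bond isomorphism of any configuration onto itself (non-vacuity of the clause). [this file, g34] -/
theorem isBondIso_self (S : Set E3) : IsBondIso S (fun x => x) := fun _ _ _ _ => Iff.rfl

/-- ★★ **(A0⁺) «GlobalChartIsoRegistrationP aHi Λ θ s»** — (A0) `GlobalChartRegistrationP` of part TB with the global registration additionally a BOND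
ISOMORPHISM (`IsBondIso`).  What (A0)'s own mechanism produces (TB: «take `w :=` S's own Hägg word with equilibrium heights/registries under `L`, `Ψ :=` the
graph isomorphism»); (A0⁺) ⇒ (A0) is the projection `globalChartRegistrationP_of_iso`.  REGISTRATION (graph) · WEAKER-than-nothing-new · TRUE-type · CUT HERE
(§X.2).  Why it might fail: as (A0) — the equilibrium chart for `S`'s global word must exist in the `s`-conformal clean Nash class near the scale-`R` chart
(edge-of-clean-window slivers, part TE/g33 §3) and the drift of `S`'s local lattice parameter (`≤ C√η·log(D/R)`) must stay inside the profile `Cg·(D/R)·η`.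
Sources: [this tree: `GlobalChartRegistrationP`, `IsGlobalReg` (TB), `IsCharted`, `homStacking_eq_layeredHom`], [ConwaySloane1999 Ch. 1 §1.3],
[EMing2006 §2], [kruzik2019 p.55 Thm 1.1.12]. [this file, g34] -/
def GlobalChartIsoRegistrationP (aHi Λ θ s : ℝ) : Prop :=
  ∀ δ : ℝ, 0 < δ → ∀ a : ℝ, 0 < a → ∃ Cg : ℝ, 1 ≤ Cg ∧ ∃ η₁ : ℝ, 0 < η₁ ∧ ∃ R₁ : ℝ, 0 < R₁ ∧
    ∀ S : Set E3, IsDoorSetP aHi δ S → (∀ q ∈ S, IsTwoShellAffineGood θ S q) →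
      ∀ η : ℝ, 0 < η → η ≤ η₁ → ∀ R : ℝ, R₁ ≤ R →
        (∀ D : ℝ, R ≤ D → NearHomH1BDE a s Λ η 4 D S (atomsIn (μS S) 0 D)) →
          ∃ (L : E3 ≃L[ℝ] E3) (w : ℤ → E3), IsEquilChart a s Λ L w ∧
            ∃ Ψ : E3 → E3, IsGlobalReg Cg η R S (LayeredHom (L : E3 →L[ℝ] E3) w) Ψ ∧ IsBondIso S Ψ

/-- ★★ **(A0♭⁺) «EquilChartBondIsoP aHi Λ θ s»** — THE EXISTENCE HALF of (A0⁺): for every `δ, a` there is `C♭ ≥ 1` (ceiling `η₁`, floor `R₁`) such that a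
θ-good door set, `η`-registered-flat to equilibrium charts at EVERY scale `D ≥ R`, admits ONE equilibrium layered chart `H = LayeredHom L w` and ONE map
`Ψ₀ : S → H` which is SIMULTANEOUSLY (i) a bijection and a bond isomorphism (`IsBondIso`: `H` carries `S`'s own GLOBAL contact graph, hence its global Hägg
word, in `Ψ₀`'s correspondence), (ii) two-sided tear-free at `4 ↦ 8`, and (iii) a registration of the window `win R` at level `C♭·η` (part Q `IsRegistered`,
radius `4`, position scale `R`) — THE SAME MAP, so the correspondence is pinned to the physical one near the origin (§X.1: untied, or tear-free-only, the
estimate half is false).  No level is asked beyond scale `R`.  A CONSEQUENCE of (A0⁺) (`equilChartBondIsoP_of_globalChartIsoRegistrationP`, PROVED; `D = R`);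
implies part TE's (A0♭) (`equilChartGraphP_of_equilChartBondIsoP`, PROVED).  EXISTENCE-type · S-dependent · WEAKER · TRUE-expected · UNDECIDED · INSTRUMENTABLE.
Mechanism: transplant `S`'s word onto the scale-`R` lattice `L` with EQUILIBRIUM heights/registries (1-D layer-chain implicit-function argument: chain Hessian
`λ_min ≥ 16.9` uniformly in the word and in `|a/d₀ − 1| ≤ 6 %`, g33 §3; lens-3 `BarlowGluingW` (PROVED) + IFT for the gluing of half-words), `Ψ₀ :=` the
label-true site correspondence; its scale-`R` levels are those of the hypothesis chart at scale `2R` transported through one affine comparison.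
Why it might fail: the equilibrium chart for the GLOBAL word must be clean for the lattice `L` pinned at scale `R` — false on the clean-window edge slivers
`d ∈ (1.03393, 1.03406) ∪ (0.90902, 0.90904)` (g33 §3) unless `η₁(a)`/the multi-scale hypothesis keeps `S`'s scale-`R` chart off them; and `S`'s local lattice
parameter may drift by `C√η·log(D/R)` across scales, so «one `L` for the whole word» needs the equilibrium branch to persist along the drift.
Sources: [this tree: `IsCharted`, `IsEquilChart`, `IsRegistered`, `homStacking_eq_layeredHom`, `pairForce_rotPi`, lens-3 `BarlowGluingW`], [EMing2006 §2],
[ConwaySloane1999 Ch. 1 §1.3], [g33 instrument `layerchain.py` run24; g34 `twin_tail.py`]. [this file, g34] -/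
def EquilChartBondIsoP (aHi Λ θ s : ℝ) : Prop :=
  ∀ δ : ℝ, 0 < δ → ∀ a : ℝ, 0 < a → ∃ Cb : ℝ, 1 ≤ Cb ∧ ∃ η₁ : ℝ, 0 < η₁ ∧ ∃ R₁ : ℝ, 0 < R₁ ∧
    ∀ S : Set E3, IsDoorSetP aHi δ S → (∀ q ∈ S, IsTwoShellAffineGood θ S q) →
      ∀ η : ℝ, 0 < η → η ≤ η₁ → ∀ R : ℝ, R₁ ≤ R →
        (∀ D : ℝ, R ≤ D → NearHomH1BDE a s Λ η 4 D S (atomsIn (μS S) 0 D)) →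
          ∃ (L : E3 ≃L[ℝ] E3) (w : ℤ → E3), IsEquilChart a s Λ L w ∧
            ∃ Ψ₀ : E3 → E3, Set.BijOn Ψ₀ S (LayeredHom (L : E3 →L[ℝ] E3) w) ∧ IsBondIso S Ψ₀ ∧
              (∀ x ∈ S, ∀ p ∈ S, dist p x ≤ 4 → dist (Ψ₀ p) (Ψ₀ x) ≤ 8) ∧ (∀ x ∈ S, ∀ p ∈ S, dist (Ψ₀ p) (Ψ₀ x) ≤ 4 → dist p x ≤ 8) ∧
              ∃ τ : E3 → ℝ, IsRegistered (Cb * η) 4 R S (atomsIn (μS S) 0 R) (LayeredHom (L : E3 →L[ℝ] E3) w) Ψ₀ τ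

/-- ★★ **(A0♯⁺) «BondIsoLevelsP aHi Λ θ s»** — THE ESTIMATE HALF of (A0⁺): for every `δ, a, C♭` there is `Cg ≥ 1` (ceiling `η₁`, floor `R₁`) such that:
GIVEN an equilibrium chart `H = LayeredHom L w` and a map `Ψ₀ : S → H` that is a bijective BOND ISOMORPHISM, two-sided tear-free, and registers `win R` at
level `C♭·η` (exactly the output of (A0♭⁺)), THAT SAME MAP is a global registration of part TB (`IsGlobalReg Cg η R`: level `Cg·(D/R)·η` in gradient and
position at every scale `D ≥ R`).  No existence content: a bond isomorphism onto a layered set is determined by its germ (L1), so the levels are a property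
of `S`'s geometry — (L2) dyadic chart comparison `‖L_{2D}∘A_{2D} − L_D∘A_D‖ ≤ C√η` by affine-fit rigidity on the overlap, telescoped to `C√η·log₂(D/R)`,
(L3) profile transport `Σ_{win D} τ₀² ≤ C(1 + log²(D/R))·η·nK ≤ Cg·(D/R)·η·nK`, (L4) interlayer slaving of `S`'s offsets to the homogeneous equilibrium
offsets of its own word (`S` is Nash; lens-3 `SlavingKernelL1` / `TubeMonotone`), (L5) position by discrete Poincaré anchored at scale `R`, (L6) the
bookkeeping `isGlobalReg_of_bijOn_levels` (PROVED below).  SLAVING/ESTIMATE-type · TRUE-type · ATTACKABLE · M–L.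
Why it might fail: the affine-fit rigidity constant of (L2) and the slaving constant of (L4) must be uniform in the word; two homogeneous equilibrium
branches for one word and one `L` would let `H` sit on a branch `S` does not follow (none seen: chain `λ_min ≥ 16.9` on 29 words × 7 strains, g33 §3).
Sources: [this tree: `RegistrationP` (part Q), `SlavingKernelL1`, `TubeMonotone`, `nash_force_balance`, `isRegistered_of_bijOn_dominating` (here)],
[kruzik2019 p.55 Thm 1.1.12 (FJM rigidity)], [Theil2006 §3], [EMing2006 §2], [census W174.md (TAG 174 (a⁗))]. [this file, g34] -/
def BondIsoLevelsP (aHi Λ θ s : ℝ) : Prop :=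
  ∀ δ : ℝ, 0 < δ → ∀ a : ℝ, 0 < a → ∀ Cb : ℝ, 1 ≤ Cb → ∃ Cg : ℝ, 1 ≤ Cg ∧ ∃ η₁ : ℝ, 0 < η₁ ∧ ∃ R₁ : ℝ, 0 < R₁ ∧
    ∀ S : Set E3, IsDoorSetP aHi δ S → (∀ q ∈ S, IsTwoShellAffineGood θ S q) →
      ∀ η : ℝ, 0 < η → η ≤ η₁ → ∀ R : ℝ, R₁ ≤ R →
        (∀ D : ℝ, R ≤ D → NearHomH1BDE a s Λ η 4 D S (atomsIn (μS S) 0 D)) →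
          ∀ (L : E3 ≃L[ℝ] E3) (w : ℤ → E3), IsEquilChart a s Λ L w →
            ∀ Ψ₀ : E3 → E3, Set.BijOn Ψ₀ S (LayeredHom (L : E3 →L[ℝ] E3) w) → IsBondIso S Ψ₀ →
              (∀ x ∈ S, ∀ p ∈ S, dist p x ≤ 4 → dist (Ψ₀ p) (Ψ₀ x) ≤ 8) → (∀ x ∈ S, ∀ p ∈ S, dist (Ψ₀ p) (Ψ₀ x) ≤ 4 → dist p x ≤ 8) →
                (∃ τ : E3 → ℝ, IsRegistered (Cb * η) 4 R S (atomsIn (μS S) 0 R) (LayeredHom (L : E3 →L[ℝ] E3) w) Ψ₀ τ) →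
                  IsGlobalReg Cg η R S (LayeredHom (L : E3 →L[ℝ] E3) w) Ψ₀

/-- ★★ **(A0⁺) ⟸ (A0♭⁺) ∧ (A0♯⁺) (PROVED)** — the node's glue: ceiling `min`, floor `max`; the chart AND THE MAP of (A0♭⁺) handed to (A0♯⁺). [this file, g34] -/
theorem globalChartIsoRegistrationP_of_bondIso_levels {aHi Λ θ s : ℝ} (hb : EquilChartBondIsoP aHi Λ θ s) (hl : BondIsoLevelsP aHi Λ θ s) :
    GlobalChartIsoRegistrationP aHi Λ θ s := by
  intro δ hδ a ha
  obtain ⟨Cb, hCb, η₁, hη₁, R₁, hR₁, Hb⟩ := hb δ hδ a ha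
  obtain ⟨Cg, hCg, η₂, hη₂, R₂, hR₂, Hl⟩ := hl δ hδ a ha Cb hCb
  refine ⟨Cg, hCg, min η₁ η₂, lt_min hη₁ hη₂, max R₁ R₂, lt_max_of_lt_left hR₁, ?_⟩
  intro S hS hgood η hη hηle R hR hms
  obtain ⟨L, w, hLw, Ψ₀, hbij, hiso, ht1, ht2, hreg⟩ :=
    Hb S hS hgood η hη (hηle.trans (min_le_left _ _)) R ((le_max_left _ _).trans hR) hms
  exact ⟨L, w, hLw, Ψ₀,
    Hl S hS hgood η hη (hηle.trans (min_le_right _ _)) R ((le_max_right _ _).trans hR) hms L w hLw Ψ₀ hbij hiso ht1 ht2 hreg, hiso⟩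

/-- ★ **(A0⁺) ⇒ (A0) (PROVED)**: forget the bond-isomorphism clause — so every column through (A0) is reached from the repaired cut. [this file, g34] -/
theorem globalChartRegistrationP_of_iso {aHi Λ θ s : ℝ} (h : GlobalChartIsoRegistrationP aHi Λ θ s) : GlobalChartRegistrationP aHi Λ θ s := by
  intro δ hδ a ha
  obtain ⟨Cg, hCg, η₁, hη₁, R₁, hR₁, H⟩ := h δ hδ a ha
  refine ⟨Cg, hCg, η₁, hη₁, R₁, hR₁, fun S hS hgood η hη hηle R hR hms => ?_⟩
  obtain ⟨L, w, hLw, Ψ, hΨ, -⟩ := H S hS hgood η hη hηle R hR hms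
  exact ⟨L, w, hLw, Ψ, hΨ⟩

/-- ★ **(A0⁺) ⇒ (A0♭⁺) (PROVED)**: the existence half is a CONSEQUENCE of (A0⁺) — take (A0⁺)'s chart and its global registration; at `D = R` the profile
`Cg·(R/R)·η` is `Cg·η`.  So (A0♭⁺) is weaker than (A0⁺), strictly unless (A0♯⁺) is free. [this file, g34] -/
theorem equilChartBondIsoP_of_globalChartIsoRegistrationP {aHi Λ θ s : ℝ} (h : GlobalChartIsoRegistrationP aHi Λ θ s) :
    EquilChartBondIsoP aHi Λ θ s := by
  intro δ hδ a ha
  obtain ⟨Cg, hCg, η₁, hη₁, R₁, hR₁, H⟩ := h δ hδ a ha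
  refine ⟨Cg, hCg, η₁, hη₁, R₁, hR₁, fun S hS hgood η hη hηle R hR hms => ?_⟩
  obtain ⟨L, w, hLw, Ψ, ⟨hbij, ht1, ht2, hlev⟩, hiso⟩ := H S hS hgood η hη hηle R hR hms
  obtain ⟨τ, hτ⟩ := hlev R le_rfl
  have hR0 : R ≠ 0 := (hR₁.trans_le hR).ne'
  refine ⟨L, w, hLw, Ψ, hbij, hiso, ht1, ht2, τ, ?_⟩
  simpa only [div_self hR0, mul_one] using hτ

/-- ★ **(A0♭⁺) ⇒ (A0♭) of part TE (PROVED)**: the repaired existence half implies g33's (forget the bond clause; the registration of `win R` is `Ψ₀` itself).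
(The converse fails: (A0♭)'s two maps are untied — §X.1.) [this file, g34] -/
theorem equilChartGraphP_of_equilChartBondIsoP {aHi Λ θ s : ℝ} (h : EquilChartBondIsoP aHi Λ θ s) : EquilChartGraphP aHi Λ θ s := by
  intro δ hδ a ha
  obtain ⟨Cb, hCb, η₁, hη₁, R₁, hR₁, H⟩ := h δ hδ a ha
  refine ⟨Cb, hCb, η₁, hη₁, R₁, hR₁, fun S hS hgood η hη hηle R hR hms => ?_⟩
  obtain ⟨L, w, hLw, Ψ₀, hbij, -, ht1, ht2, τ, hτ⟩ := H S hS hgood η hη hηle R hR hms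
  exact ⟨L, w, hLw, ⟨Ψ₀, τ, hτ⟩, Ψ₀, hbij, ht1, ht2⟩

/-- ★ **(L6) the level bookkeeping of (A0♯⁺), PROVED — `IsRegistered` from a DOMINATING PROFILE**: a bijection `Ψ : S → H` that is reverse-tear-free
(`dist (Ψ p) (Ψ x) ≤ 4 ⇒ dist p x ≤ 8`), with a profile `τ ≥ 0` on the chunk `Q ⊆ S` dominating the distortion of every pair `(x, p)`, `x ∈ Q`, `p ∈ S`,
`dist p x ≤ 8`, and the two scalar level inequalities, IS a registration of `Q` at radius `4` (part Q `IsRegistered`): injective, into `H`, two-sided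
environment-close (forward: `q := Ψ p`; backward: `q = Ψ p` by surjectivity, `p` within `8` by reverse tear-freeness), bond clause, levels.  Reduces
(A0♯⁺) at each scale to TWO SCALAR INEQUALITIES for the given map. [this file, g34] -/
theorem isRegistered_of_bijOn_dominating {κ ρ : ℝ} {S Q H : Set E3} {Ψ : E3 → E3} {τ : E3 → ℝ} (hQ : Q ⊆ S) (hbij : Set.BijOn Ψ S H)
    (ht2 : ∀ x ∈ S, ∀ p ∈ S, dist (Ψ p) (Ψ x) ≤ 4 → dist p x ≤ 8) (hτ0 : ∀ x ∈ Q, 0 ≤ τ x)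
    (hdom : ∀ x ∈ Q, ∀ p ∈ S, dist p x ≤ 8 → dist (p - x) (Ψ p - Ψ x) ≤ τ x)
    (hgrad : ∑ᶠ x ∈ Q, τ x ^ 2 ≤ κ * nK Q) (hpos : ∑ᶠ x ∈ Q, ‖x - Ψ x‖ ^ 2 ≤ κ * ρ ^ 2 * nK Q) :
    IsRegistered κ 4 ρ S Q H Ψ τ := by
  have h48 : (4 : ℝ) ≤ 8 := by norm_num
  refine ⟨hbij.injOn.mono hQ, hbij.mapsTo.mono_left hQ, fun x hx => ⟨hτ0 x hx, ?_, ?_⟩,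
    fun x hx p hp hpx => hdom x hx p (hQ hp) (hpx.trans h48), hgrad, hpos⟩
  · intro p hp hpx
    exact ⟨Ψ p, hbij.mapsTo hp, hdom x hx p hp (hpx.trans h48)⟩
  · intro q hq hqx
    obtain ⟨p, hp, rfl⟩ := hbij.surjOn hq
    exact ⟨p, hp, hdom x hx p hp (ht2 x (hQ hx) p hp hqx)⟩

/-- ★ **(L6′) `IsGlobalReg` from scale-wise dominating profiles (PROVED)**: a bijective two-sided tear-free `Ψ : S → H` with, at every scale `D ≥ R`, a
dominating profile on `win D` obeying the gradient level `Cg·(D/R)·η·nK` and the position level `Cg·(D/R)·η·D²·nK` is a global registration of part TB.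
What (L1)–(L5) of (A0♯⁺) must deliver is therefore exactly: the profile and the two sums. [this file, g34] -/
theorem isGlobalReg_of_bijOn_levels {Cg η R : ℝ} {S H : Set E3} {Ψ : E3 → E3} (hbij : Set.BijOn Ψ S H)
    (ht1 : ∀ x ∈ S, ∀ p ∈ S, dist p x ≤ 4 → dist (Ψ p) (Ψ x) ≤ 8) (ht2 : ∀ x ∈ S, ∀ p ∈ S, dist (Ψ p) (Ψ x) ≤ 4 → dist p x ≤ 8)
    (hlev : ∀ D : ℝ, R ≤ D → ∃ τ : E3 → ℝ, (∀ x ∈ atomsIn (μS S) 0 D, 0 ≤ τ x) ∧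
      (∀ x ∈ atomsIn (μS S) 0 D, ∀ p ∈ S, dist p x ≤ 8 → dist (p - x) (Ψ p - Ψ x) ≤ τ x) ∧
      ∑ᶠ x ∈ atomsIn (μS S) 0 D, τ x ^ 2 ≤ Cg * (D / R) * η * nK (atomsIn (μS S) 0 D) ∧
      ∑ᶠ x ∈ atomsIn (μS S) 0 D, ‖x - Ψ x‖ ^ 2 ≤ Cg * (D / R) * η * D ^ 2 * nK (atomsIn (μS S) 0 D)) :
    IsGlobalReg Cg η R S H Ψ := by
  refine ⟨hbij, ht1, ht2, fun D hD => ?_⟩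
  obtain ⟨τ, hτ0, hdom, hg, hp⟩ := hlev D hD
  exact ⟨τ, isRegistered_of_bijOn_dominating (atomsIn_subset S D) hbij ht2 hτ0 hdom hg hp⟩

/-- ★ **non-vacuity of (A0♯⁺)'s hypothesis package**: an equilibrium layered chart, viewed as a configuration, carries the data (A0♭⁺) concludes and
(A0♯⁺) assumes — registered to itself by the identity (a bijective bond isomorphism, tear-free) at level `0 ≤ C♭·η` (part Q `isRegistered_self`). [this file, g34] -/
theorem bondIso_data_self (L : E3 ≃L[ℝ] E3) (w : ℤ → E3) (R : ℝ) :
    Set.BijOn (fun x => x) (LayeredHom (L : E3 →L[ℝ] E3) w) (LayeredHom (L : E3 →L[ℝ] E3) w) ∧ IsBondIso (LayeredHom (L : E3 →L[ℝ] E3) w) (fun x => x) ∧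
      (∀ x ∈ LayeredHom (L : E3 →L[ℝ] E3) w, ∀ p ∈ LayeredHom (L : E3 →L[ℝ] E3) w, dist p x ≤ 4 → dist p x ≤ 8) ∧
      ∃ τ : E3 → ℝ, IsRegistered 0 4 R (LayeredHom (L : E3 →L[ℝ] E3) w) (atomsIn (μS (LayeredHom (L : E3 →L[ℝ] E3) w)) 0 R)
        (LayeredHom (L : E3 →L[ℝ] E3) w) (fun x => x) τ :=
  ⟨Set.bijOn_id _, isBondIso_self _, fun _ _ _ _ h => h.trans (by norm_num), fun _ => 0, isRegistered_self 4 R (atomsIn_subset _ R)⟩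

/-- ★★★ **COLUMN `_16XH9` — SEVENTEEN opaque leaves** (the repaired cut in place of (A0)):
`LatticeLiouvilleCert → LayeredLiouvilleCert → R_G → X → Z_E → P → T → U♮ → A0♭⁺ → A0♯⁺ → FF → E → A⁰ → D⁰ → C♭ → R_W → PeriodicBulkGapDoor 2 →
VisibleGap (1/50) ∧ PertRegime (1/50)` (all at `(aHi; Λ, θ, s) = (1; 2, 1/16, 1/50)`), via `_16XH7` with `h0 :=` projection ∘ glue.  Supersedes `_16XH8`
(whose leaf (A0♯) is refuted, §X.1).  Residual of record unchanged: (R_W) alone. [this file, g34] -/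
theorem gap_and_pert_1_50_of_certs_16XH9 (hL : LatticeLiouvilleCert) (hL' : LayeredLiouvilleCert)
    (hR : OscRigidityL2BDPG 1 2 (1 / 16) (1 / 16)) (hX : ExcessFlatnessControlP 1 2 (1 / 16) (1 / 16))
    (hE : ExcessChartLocalisationP 1 2 (1 / 16) (1 / 50)) (hP : RegistrationP 1 2 (1 / 16) (1 / 50))
    (hT : TailDominationCert) (hU : UniformTameStability (1 / 50) 2)
    (hb : EquilChartBondIsoP 1 2 (1 / 16) (1 / 50)) (hl : BondIsoLevelsP 1 2 (1 / 16) (1 / 50))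
    (hF : TailForceSlavingP 1 2 (1 / 16) (1 / 50))
    (hE' : LipDualLinearisationP 1 2 (1 / 16) (1 / 50)) (hA : L2HarmonicApproxP 1 2 (1 / 16) (1 / 50))
    (hD : PositionDecayPL 1 2 (1 / 16) (1 / 50)) (hC : PositionCaccioppoliPG 1 2 (1 / 16) (1 / 50))
    (hW : WildFractionPG 1 2 (1 / 16) (1 / 50)) (hG : PeriodicBulkGapDoor 2) : VisibleGap (1 / 50) ∧ PertRegime (1 / 50) :=
  gap_and_pert_1_50_of_certs_16XH7 hL hL' hR hX hE hP hT hU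
    (globalChartRegistrationP_of_iso (globalChartIsoRegistrationP_of_bondIso_levels hb hl)) hF hE' hA hD hC hW hG

/-- ★ **COLUMN `_16XH9W`** — the same with (A1) «WildReRegistrationPG» in place of (R_W). [this file, g34] -/
theorem gap_and_pert_1_50_of_certs_16XH9W (hL : LatticeLiouvilleCert) (hL' : LayeredLiouvilleCert)
    (hR : OscRigidityL2BDPG 1 2 (1 / 16) (1 / 16)) (hX : ExcessFlatnessControlP 1 2 (1 / 16) (1 / 16))
    (hE : ExcessChartLocalisationP 1 2 (1 / 16) (1 / 50)) (hP : RegistrationP 1 2 (1 / 16) (1 / 50))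
    (hT : TailDominationCert) (hU : UniformTameStability (1 / 50) 2)
    (hb : EquilChartBondIsoP 1 2 (1 / 16) (1 / 50)) (hl : BondIsoLevelsP 1 2 (1 / 16) (1 / 50))
    (hF : TailForceSlavingP 1 2 (1 / 16) (1 / 50))
    (hE' : LipDualLinearisationP 1 2 (1 / 16) (1 / 50)) (hA : L2HarmonicApproxP 1 2 (1 / 16) (1 / 50))
    (hD : PositionDecayPL 1 2 (1 / 16) (1 / 50)) (hC : PositionCaccioppoliPG 1 2 (1 / 16) (1 / 50))
    (h1 : WildReRegistrationPG 1 2 (1 / 16) (1 / 50)) (hG : PeriodicBulkGapDoor 2) : VisibleGap (1 / 50) ∧ PertRegime (1 / 50) :=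
  gap_and_pert_1_50_of_certs_16XH9 hL hL' hR hX hE hP hT hU hb hl hF hE' hA hD hC (wildFractionPG_of_wildReRegistrationPG h1) hG


end Summit.AtomisticToContinuum.Crystallization.Theorems.ChartedZeroExcessLayeredLatticeLiouville

end
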